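import Literature.Analysis.FluidPDE.TaoEnstrophyLocalisationParts
import Literature.Analysis.FluidPDE.NSVelocityUniqueness
import Literature.Analysis.FluidPDE.TaoEnergyLocalisationProofs
import HarnessLib

/-!
# Tao's unconditional uniqueness (Cor. 11.4): the velocity form from the current leaves

Assembly file (no new facts). `NSVelocityUniqueness.lean` **proves** the `B`-side of
Remark 11.3's chain for Cor. 11.4 — the composite of Cor. 4.3 and Thm. 5.4 (iii),
`NS.tao2011_velocity_eq_of_memSobolevX_holds` — and `TaoEnstrophyLocalisationParts.lean` reduces
the `A`-side (Cor. 11.1, bounded enstrophy) to its printed leaves, assembling Cor. 11.4 in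
`NS.tao_unconditional_uniqueness_of_leaves` with the `B`-side still a hypothesis. The two files
are siblings in the import graph (both import `NSUnconditionalUniquenessProofs.lean`), so the
assembly with the `B`-side discharged is recorded here:

* `NS.tao_unconditional_uniqueness_of_leaves'` — Cor. 11.4 as printed, its velocity form
  `NS.tao_unconditional_uniqueness_velocity` and the duplicate vendoring
  `NS.tao_finite_energy_velocity_uniqueness`, from exactly three named facts:
  Lemma 8.1 (`NS.tao_finite_energy_smooth_energy_bound`, global energy inequality),
  Prop. 9.1 (`NS.tao2011_boundedTotalSpeed`, bounded total speed) and the a priori form of the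
  §10 argument (`NS.tao2011_enstrophyLocalisation_exterior_apriori`, Thm. 10.1 with its two global
  inputs as hypotheses);
* `NS.tao_unconditional_uniqueness_velocity_of_leaves` — the velocity form alone;
* `NS.tao_unconditional_uniqueness_velocity_of_pressure_leaves` — the same with Lemma 8.1
  replaced by its own two printed inputs, Lemma 4.1 (i) (`NS.tao_pressure_normalisation`) and the
  estimate of the pressure term `X₅` (`NS.tao2011_pressureTerm_estimate`), through the proved
  `NS.tao_finite_energy_smooth_energy_bound_of_pressure` (`TaoEnergyLocalisationProofs.lean`).

Hence the discharge `NS.tao_unconditional_uniqueness_velocity_holds` is the one-liner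
`tao_unconditional_uniqueness_velocity_of_pressure_leaves hN hX5 hP hA'` as soon as the four
remaining named facts (Lemma 4.1 (i), the `X₅` estimate, Prop. 9.1, §10 a priori) have `_holds`
theorems; none is asserted here.

## Mathlib / tree search

`lean search 'of_leaves|_holds' --decl` in `Literature/Analysis/FluidPDE`: the assemblies above do
not exist with the `B`-side discharged (`tao_unconditional_uniqueness_of_leaves` keeps
`hB : tao2011_velocity_eq_of_memSobolevX`); Mathlib has no Navier–Stokes theory.

## References

* T. Tao, *Localisation and compactness properties of the Navier–Stokes global regularity
  problem*, Anal. PDE 6 (2013), 25–107; arXiv:1108.1165 (`Tao2011`): Cor. 11.4 and Remark 11.3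
  (arXiv Cor. 71, Rem. 70, p. 36), Cor. 11.1 (arXiv Cor. 68, p. 36), Thm. 10.1 (arXiv Thm. 59,
  p. 30), Prop. 9.1 (arXiv Prop. 52, p. 27), Lemma 8.1 (arXiv Lemma 44, p. 24), Lemma 4.1 and
  Cor. 4.3 (arXiv Lemma 25, Cor. 27, pp. 14–15), Thm. 5.4 (iii) (arXiv Thm. 31, p. 18).
-/

noncomputable section

namespace Literature.Analysis.FluidPDE

/-- **Cor. 11.4 from the current leaves, `B`-side discharged.** Lemma 8.1, Prop. 9.1 and the
a priori form of §10 give Cor. 11.4 as printed (normalised pressures), its velocity form and the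
duplicate vendoring `tao_finite_energy_velocity_uniqueness`: `tao_unconditional_uniqueness_of_leaves`
fed with the proved `tao2011_velocity_eq_of_memSobolevX_holds` (Cor. 4.3 + Thm. 5.4 (iii)).
[cite: Tao2011, Cor. 11.4 (Remark 11.3)] -/
theorem tao_unconditional_uniqueness_of_leaves' (hL : tao_finite_energy_smooth_energy_bound)
    (hP : tao2011_boundedTotalSpeed) (hA' : tao2011_enstrophyLocalisation_exterior_apriori) :
    tao_unconditional_uniqueness ∧ tao_unconditional_uniqueness_velocity ∧
      tao_finite_energy_velocity_uniqueness :=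
  tao_unconditional_uniqueness_of_leaves hL hP hA' tao2011_velocity_eq_of_memSobolevX_holds

/-- **Cor. 11.4 (velocity form) from the current leaves**: Lemma 8.1, Prop. 9.1 and the a priori
form of §10. [cite: Tao2011, Cor. 11.4 (Remark 11.3)] -/
theorem tao_unconditional_uniqueness_velocity_of_leaves (hL : tao_finite_energy_smooth_energy_bound)
    (hP : tao2011_boundedTotalSpeed) (hA' : tao2011_enstrophyLocalisation_exterior_apriori) :
    tao_unconditional_uniqueness_velocity :=
  (tao_unconditional_uniqueness_of_leaves' hL hP hA').2.1

/-- **Cor. 11.4 (velocity form) from the finest current leaves**: Lemma 4.1 (i) (pressure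
normalisation) and the estimate of the pressure term `X₅` give Lemma 8.1
(`tao_finite_energy_smooth_energy_bound_of_pressure`), whence the previous assembly applies.
[cite: Tao2011, Cor. 11.4 (Remark 11.3, Lemma 8.1, Lemma 4.1)] -/
theorem tao_unconditional_uniqueness_velocity_of_pressure_leaves (hN : tao_pressure_normalisation)
    (hX5 : tao2011_pressureTerm_estimate) (hP : tao2011_boundedTotalSpeed)
    (hA' : tao2011_enstrophyLocalisation_exterior_apriori) :
    tao_unconditional_uniqueness_velocity :=
  tao_unconditional_uniqueness_velocity_of_leaves
    (tao_finite_energy_smooth_energy_bound_of_pressure hN hX5) hP hA'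

end Literature.Analysis.FluidPDE

end
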